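import Mathlib
import HarnessLib

/-!
# courier split of the staged transcript `OSWMechanismConeGates.lean` — part 01 of 01

1-D model (gCLM/OSW), computer-assisted; not Euler/NS.  Filed under `Summits/NavierStokesRegularity/OSWSelfSimilar/` by a prover-role courier on behalf of the
mechanism seat pub-oswblow-mech (planner-pub-oswblow-mech-g31-0), cell pub-oswblow (host summit NavierStokesRegularity); the gate admits the path but
not role planner.  CONTENT = the staged transcript `pub-oswblow-mech/lean/OSWMechanismConeGates.lean` (sha256 01651dbeecf89cb1…,
222 lines), source lines 27–222, UNCHANGED except: (i) namespace prefix `OSWSelfSimilar.Mechanism` → `Summit.NavierStokesRegularity.OSWSelfSimilar.Mechanism`;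
(ii) [parts >= 02 only: the frames open at the cut are re-opened above the body and closed at the end; nothing to re-open here]
(iii) this docstring and, below it, the transcript's own module documentation VERBATIM (renamed).  Generated by `pub-oswblow-mech/lean/courier/make_split.py`; the parts must be filed IN ORDER
(each imports its predecessor).  First/last declarations here: `preconnected_subset_of_relClopen` … `coneSet_eq_Ici` (5 in this part).
AI-written transcript; kernel-checked on the farm as ONE file before splitting (see the kit's CHECKS); to be checked, not trusted.
-/

/-!
# OSWMechanismConeGates — the topological skeleton of COROLLARY 36.8 (MECHANISM v31b, §36.7), kernel-checked

**1-D model (gCLM/OSW), computer-assisted; not Euler/NS.**  AI-written; to be checked, not trusted.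
Cell `pub-oswblow`, mechanism seat, generation 31 (v31d companion).  Mathlib only; no `sorry`, no axiom
beyond the standard three.  Nothing here is specific to the profile equation: the analytic inputs of
COROLLARY 36.8 — THEOREM M46(b) (the cone set `S` is closed in the path domain and open relative to
`P = {p ≥ 3}`), continuity of the sink exponent `p`, `p → 1` at the De Gregorio end, the uniqueness
hypothesis (U₃) transported to the parameter line, and the orientation at `σ₃` — enter as HYPOTHESES,
and what is checked is the point-set topology that turns them into the conclusions
(a) 'boundary parameters of the cone set have p = 3', (b) 'the first cone parameter exists and is a gate',
(d1) 'S = [σ₃, ∞) exactly, p < 3 before, p > 3 after'.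

* `preconnected_subset_of_relClopen` — M46(b) in the form used throughout §36.7: a preconnected subset
  of `P` that meets `S` lies in `S` (S ⊆ P ⊆ A, S closed in A, S open relative to P).
* `gate_at_level_three` — COROLLARY 36.8(a): a point adherent to both `S` and its complement lies in `S`
  and has `p = 3` (ambient version: `p` continuous on the whole space, `S` closed).
* `first_gate` — COROLLARY 36.8(b): on `(0, ∞)`, if `p < 3` near `0⁺` and `S ≠ ∅`, then `sInf S ∈ S`,
  `p (sInf S) = 3`, and nothing below `sInf S` is in `S`.
* `coneSet_eq_Ici` — COROLLARY 36.8(d1): under uniqueness of the level-3 parameter `σ₃ ∈ S`, smallness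
  near `0⁺` and one parameter beyond `σ₃` with `p > 3`: `p < 3` on `(0, σ₃)`, `p > 3` on `(σ₃, ∞)`, and
  `S = Set.Ici σ₃`.
-/

namespace Summit.NavierStokesRegularity.OSWSelfSimilar.Mechanism.ConeGates

open Set

/-- THEOREM M46(b) ⟹ 'S is a union of components of P', in the operative form: if `S ⊆ P ⊆ A`,
`S = C ∩ A` with `C` closed (S closed in A) and `S = U ∩ P` with `U` open (S open relative to P), then every
preconnected `I ⊆ P` meeting `S` is contained in `S`. -/
theorem preconnected_subset_of_relClopen {X : Type*} [TopologicalSpace X]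
    {A P S C U I : Set X} (hPA : P ⊆ A)
    (hC : IsClosed C) (hSC : S = C ∩ A) (hU : IsOpen U) (hSU : S = U ∩ P)
    (hI : IsPreconnected I) (hIP : I ⊆ P) (hIS : (I ∩ S).Nonempty) : I ⊆ S := by
  by_contra h
  obtain ⟨x, hxI, hxS⟩ := Set.not_subset.mp h
  have hcover : I ⊆ U ∪ Cᶜ := by
    intro y hy
    by_cases hyS : y ∈ S
    · left
      rw [hSU] at hyS
      exact hyS.1
    · right
      intro hyC
      apply hyS
      rw [hSC]
      exact ⟨hyC, hPA (hIP hy)⟩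
  have h1 : (I ∩ U).Nonempty := by
    obtain ⟨z, hzI, hzS⟩ := hIS
    rw [hSU] at hzS
    exact ⟨z, hzI, hzS.1⟩
  have h2 : (I ∩ Cᶜ).Nonempty := by
    refine ⟨x, hxI, ?_⟩
    intro hxC
    apply hxS
    rw [hSC]
    exact ⟨hxC, hPA (hIP hxI)⟩
  obtain ⟨w, hwI, hwU, hwC⟩ := hI U Cᶜ hU hC.isOpen_compl hcover h1 h2
  apply hwC
  have hwS : w ∈ S := by
    rw [hSU]
    exact ⟨hwU, hIP hwI⟩
  rw [hSC] at hwS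
  exact hwS.1

/-- COROLLARY 36.8(a) (THE GATES HAVE p = 3), ambient form: `p` continuous, `S` closed and
`S = U ∩ {p ≥ 3}` with `U` open; a point adherent to `S` and to `Sᶜ` lies in `S` and has `p = 3`. -/
theorem gate_at_level_three {X : Type*} [TopologicalSpace X] {p : X → ℝ} (hp : Continuous p)
    {S U : Set X} (hcl : IsClosed S) (hU : IsOpen U) (hSU : S = U ∩ {x | 3 ≤ p x})
    {x : X} (hx : x ∈ closure S) (hx' : x ∈ closure Sᶜ) : x ∈ S ∧ p x = 3 := by
  have hxS : x ∈ S := hcl.closure_subset hx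
  refine ⟨hxS, ?_⟩
  have hx2 : x ∈ U ∩ {x | 3 ≤ p x} := by rw [← hSU]; exact hxS
  have hge : 3 ≤ p x := hx2.2
  by_contra hne
  have hgt : 3 < p x := lt_of_le_of_ne hge (fun h => hne h.symm)
  have hV : IsOpen {y | (3 : ℝ) < p y} := isOpen_lt continuous_const hp
  have hW : IsOpen (U ∩ {y | (3 : ℝ) < p y}) := hU.inter hV
  obtain ⟨w, ⟨hwU, hwV⟩, hwS⟩ := (mem_closure_iff.mp hx') _ hW ⟨hx2.1, hgt⟩
  apply hwS
  have hwV' : (3 : ℝ) < p w := hwV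
  rw [hSU]
  exact ⟨hwU, show (3 : ℝ) ≤ p w from le_of_lt hwV'⟩

/-- On an interval `[a, b] ⊂ (0, ∞)` a function continuous on `(0, ∞)` with `p a < 3 ≤ p b` (or
`p a ≤ 3 < p b`, …) takes the value `3`; the four sign patterns used below, packaged once. -/
theorem level_three_between {p : ℝ → ℝ} (hp : ContinuousOn p (Ioi 0)) {a b : ℝ} (ha : 0 < a)
    (hab : a ≤ b) (h : (p a ≤ 3 ∧ 3 ≤ p b) ∨ (p b ≤ 3 ∧ 3 ≤ p a)) : ∃ c ∈ Icc a b, p c = 3 := by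
  have hc : ContinuousOn p (Icc a b) := hp.mono (fun x hx => lt_of_lt_of_le ha hx.1)
  rcases h with ⟨h1, h2⟩ | ⟨h1, h2⟩
  · exact intermediate_value_Icc hab hc ⟨h1, h2⟩
  · exact intermediate_value_Icc' hab hc ⟨h1, h2⟩

/-- COROLLARY 36.8(b) (THE FIRST GATE ALONG 𝔎): `S ⊆ {σ > 0, p σ ≥ 3}`, `S` closed in `(0, ∞)` and open
relative to `{σ > 0, p σ ≥ 3}`, `p < 3` on some `(0, σ']`, `S ≠ ∅`. Then `σₑ := sInf S ∈ S`, `p σₑ = 3`,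
and no `σ < σₑ` lies in `S`. -/
theorem first_gate {p : ℝ → ℝ} {S C U : Set ℝ} (hp : ContinuousOn p (Ioi 0))
    (hSP : S ⊆ {σ | 0 < σ ∧ 3 ≤ p σ})
    (hC : IsClosed C) (hSC : S = C ∩ Ioi 0) (hU : IsOpen U) (hSU : S = U ∩ {σ | 0 < σ ∧ 3 ≤ p σ})
    (hsmall : ∃ σ', 0 < σ' ∧ ∀ σ, 0 < σ → σ ≤ σ' → p σ < 3) (hne : S.Nonempty) :
    sInf S ∈ S ∧ p (sInf S) = 3 ∧ ∀ σ, σ < sInf S → σ ∉ S := by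
  have hS_U : ∀ σ, σ ∈ S ↔ (σ ∈ U ∧ (0 < σ ∧ 3 ≤ p σ)) := fun σ => by rw [hSU]; exact Iff.rfl
  have hS_C : ∀ σ, σ ∈ S ↔ (σ ∈ C ∧ 0 < σ) := fun σ => by rw [hSC]; exact Iff.rfl
  obtain ⟨σ', hσ'0, hσ'⟩ := hsmall
  -- S ⊆ (σ', ∞): below σ' the exponent is < 3
  have hSgt : ∀ σ ∈ S, σ' < σ := by
    intro σ hσ
    have h := hSP hσ
    by_contra hle
    push Not at hle
    have := hσ' σ h.1 hle
    linarith [h.2]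
  have hbdd : BddBelow S := ⟨σ', fun σ hσ => le_of_lt (hSgt σ hσ)⟩
  -- S is closed in ℝ: S = C ∩ [σ', ∞)
  have hScl : IsClosed S := by
    have hSeq : S = C ∩ Ici σ' := by
      ext σ
      constructor
      · intro hσ
        exact ⟨((hS_C σ).mp hσ).1, le_of_lt (hSgt σ hσ)⟩
      · rintro ⟨hσC, hσ'le⟩
        exact (hS_C σ).mpr ⟨hσC, lt_of_lt_of_le hσ'0 hσ'le⟩
    rw [hSeq]
    exact hC.inter isClosed_Ici
  have hmem : sInf S ∈ S := hScl.csInf_mem hne hbdd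
  have hbelow : ∀ σ, σ < sInf S → σ ∉ S := by
    intro σ hσ hσS
    exact absurd (csInf_le hbdd hσS) (not_le.mpr hσ)
  refine ⟨hmem, ?_, hbelow⟩
  -- p (sInf S) = 3: otherwise a whole neighbourhood of sInf S inside U ∩ {σ > 0, p > 3} lies in S
  have h0 : 0 < sInf S := (hSP hmem).1
  have hge : 3 ≤ p (sInf S) := (hSP hmem).2
  by_contra hne3
  have hgt : 3 < p (sInf S) := lt_of_le_of_ne hge (fun h => hne3 h.symm)
  have hmemU : sInf S ∈ U := ((hS_U (sInf S)).mp hmem).1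
  have hV : IsOpen (Ioi (0 : ℝ) ∩ p ⁻¹' (Ioi 3)) := hp.isOpen_inter_preimage isOpen_Ioi isOpen_Ioi
  have hW : IsOpen (U ∩ (Ioi (0 : ℝ) ∩ p ⁻¹' (Ioi 3))) := hU.inter hV
  have hxW : sInf S ∈ U ∩ (Ioi (0 : ℝ) ∩ p ⁻¹' (Ioi 3)) := ⟨hmemU, h0, hgt⟩
  obtain ⟨δ, hδ, hball⟩ := Metric.isOpen_iff.mp hW (sInf S) hxW
  set y := sInf S - δ / 2 with hy
  have hyball : y ∈ Metric.ball (sInf S) δ := by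
    rw [Metric.mem_ball, Real.dist_eq, hy]
    rw [show sInf S - δ / 2 - sInf S = -(δ / 2) by ring, abs_neg, abs_of_pos (by linarith)]
    linarith
  obtain ⟨hyU, hy0, hyp⟩ := hball hyball
  have hyp' : (3 : ℝ) < p y := hyp
  have hy0' : (0 : ℝ) < y := hy0
  have hyS : y ∈ S := (hS_U y).mpr ⟨hyU, hy0', le_of_lt hyp'⟩
  have hlt : y < sInf S := by rw [hy]; linarith
  exact hbelow y hlt hyS

/-- COROLLARY 36.8(d1) (UNDER UNIQUENESS, THE CONE SET ALONG 𝔎 IS EXACTLY `[σ₃, ∞)`): the hypotheses are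
those of `first_gate` plus: the only parameter with `p = 3` is `σ₃` ((U₃) and injectivity of γ on γ⁻¹(𝔑)),
`σ₃ ∈ S` (the certified rung is in the cone), and one parameter `τ > σ₃` with `p τ > 3` (orientation,
COROLLARY 36.5(a2),(a3)). Conclusion: `p < 3` on `(0, σ₃)`, `p > 3` on `(σ₃, ∞)`, `S = [σ₃, ∞)`. -/
theorem coneSet_eq_Ici {p : ℝ → ℝ} {S C U : Set ℝ} {σ₃ : ℝ}
    (hp : ContinuousOn p (Ioi 0))
    (hSP : S ⊆ {σ | 0 < σ ∧ 3 ≤ p σ})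
    (hC : IsClosed C) (hSC : S = C ∩ Ioi 0) (hU : IsOpen U) (hSU : S = U ∩ {σ | 0 < σ ∧ 3 ≤ p σ})
    (huniq : ∀ σ, 0 < σ → p σ = 3 → σ = σ₃) (hσ₃ : σ₃ ∈ S)
    (hsmall : ∃ σ', 0 < σ' ∧ ∀ σ, 0 < σ → σ ≤ σ' → p σ < 3)
    (horient : ∃ τ, σ₃ < τ ∧ 3 < p τ) :
    (∀ σ, 0 < σ → σ < σ₃ → p σ < 3) ∧ (∀ σ, σ₃ < σ → 3 < p σ) ∧ S = Ici σ₃ := by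
  have h3 : 0 < σ₃ := (hSP hσ₃).1
  obtain ⟨σ', hσ'0, hσ'⟩ := hsmall
  -- p < 3 on (0, σ₃)
  have hbefore : ∀ σ, 0 < σ → σ < σ₃ → p σ < 3 := by
    intro σ hσ0 hσ3
    by_contra hge
    push Not at hge
    -- a point t₀ ≤ σ with p t₀ < 3
    set t₀ := min σ σ' with ht₀
    have ht₀0 : 0 < t₀ := lt_min hσ0 hσ'0
    have ht₀σ : t₀ ≤ σ := min_le_left _ _
    have hpt₀ : p t₀ < 3 := hσ' t₀ ht₀0 (min_le_right _ _)
    obtain ⟨c, hc, hpc⟩ := level_three_between hp ht₀0 ht₀σ (Or.inl ⟨le_of_lt hpt₀, hge⟩)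
    have hc0 : 0 < c := lt_of_lt_of_le ht₀0 hc.1
    have := huniq c hc0 hpc
    linarith [hc.2]
  -- p > 3 on (σ₃, ∞)
  have hafter : ∀ σ, σ₃ < σ → 3 < p σ := by
    intro σ hσ
    have hσ0 : 0 < σ := lt_trans h3 hσ
    by_contra hle
    push Not at hle
    have hne : p σ ≠ 3 := by
      intro h
      have := huniq σ hσ0 h
      linarith
    have hlt : p σ < 3 := lt_of_le_of_ne hle hne
    obtain ⟨τ, hτ3, hpτ⟩ := horient
    have hτ0 : 0 < τ := lt_trans h3 hτ3
    rcases lt_trichotomy σ τ with hστ | hστ | hστ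
    · obtain ⟨c, hc, hpc⟩ := level_three_between hp hσ0 (le_of_lt hστ) (Or.inl ⟨le_of_lt hlt, le_of_lt hpτ⟩)
      have := huniq c (lt_of_lt_of_le hσ0 hc.1) hpc
      linarith [hc.1]
    · rw [hστ] at hlt
      linarith
    · obtain ⟨c, hc, hpc⟩ := level_three_between hp hτ0 (le_of_lt hστ) (Or.inr ⟨le_of_lt hlt, le_of_lt hpτ⟩)
      have := huniq c (lt_of_lt_of_le hτ0 hc.1) hpc
      linarith [hc.1]
  refine ⟨hbefore, hafter, ?_⟩
  apply Subset.antisymm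
  · intro σ hσ
    have h := hSP hσ
    by_contra hlt
    simp only [mem_Ici, not_le] at hlt
    have := hbefore σ h.1 hlt
    linarith [h.2]
  · -- [σ₃, ∞) is preconnected, lies in P, and meets S at σ₃
    have hIP : Ici σ₃ ⊆ {σ | 0 < σ ∧ 3 ≤ p σ} := by
      intro σ hσ
      rcases eq_or_lt_of_le (mem_Ici.mp hσ) with h | h
      · rw [← h]; exact hSP hσ₃
      · exact ⟨lt_trans h3 h, le_of_lt (hafter σ h)⟩
    exact preconnected_subset_of_relClopen (A := Ioi 0) (fun σ h => h.1) hC hSC hU hSU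
      isPreconnected_Ici hIP ⟨σ₃, mem_Ici.mpr le_rfl, hσ₃⟩

end Summit.NavierStokesRegularity.OSWSelfSimilar.Mechanism.ConeGates
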